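import Summits.QuantumAdvantage.QuantumAdvantage.Theorems.CharDialFormJuntaB

/-! # CharDialFormJuntaC — part 3/6 (mechanical split for landing of `CharDialFormJunta`; content verbatim; scopes re-opened with their variables) -/

noncomputable section
open Finset

namespace Summit.QuantumAdvantage.AdviceFreeQNC0.WindowCounter
open Summit.QuantumAdvantage.AdviceFreeQNC0

section FormDial
variable (p : ℕ) [Fact p.Prime] {n : ℕ}

/-- **the scheduled bound for the form-twisted signed sums of a window strategy.** -/
theorem norm_PG_form_le (hp : 5 ≤ p) (a : Fin n → ZMod p) {t : ZMod p} (ht : t ≠ 0) (r : ZMod 3) (ℓ : ℕ)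
    (y : Fin (n + 1) → (Fin n → Bool) → Bool) (hy : WindowLocal ℓ y) (hℓn : ℓ ≤ n + 1) (c w : ℕ) :
    ‖PG (muF p a t r) (Etab ℓ y c w) (fun _ r P => ftab ℓ y c w r P) n 0 [] 0‖ ≤
      2 ^ n * kappaF p ^ nb (gdF p a) (2 * ℓ) 0 n := by
  unfold kappaF
  exact norm_PG_sched _ _ _ (norm_muF p a t r) (betaF_nonneg p) (gdF p a) (XF p a) (XF' p a) (XF'_ne p a)
    (wt_XF p a) (fun k hk σ σ' => pair_XF p hp a ht r k hk σ σ') (W := 2 * ℓ)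
    (fun k ρ ρ' b P h => Etab_local ℓ y c w hy (by omega) k ρ ρ' b P h) (Etab_periodic ℓ y c w)
    (fun k ρ ρ' P h => ftab_local ℓ y c w hy (by omega) hℓn ρ ρ' P h) (fun k r P => ftab_periodic ℓ y c w r P)
    (fun k r P => norm_ftab ℓ y c w r P) n 0 [] 0

/-- CharDialFormJuntaC helper `norm_PG_form_plain_le` (decomp-qadv land package; see the module docstring). -/
theorem norm_PG_form_plain_le (hp : 5 ≤ p) (a : Fin n → ZMod p) {t : ZMod p} (ht : t ≠ 0) (r : ZMod 3) (ℓ : ℕ) :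
    ‖PG (muF p a t r) (fun _ _ _ _ => false) (fun _ _ _ => 1) n 0 [] 0‖ ≤ 2 ^ n * kappaF p ^ nb (gdF p a) (2 * ℓ) 0 n := by
  unfold kappaF
  exact norm_PG_sched _ _ _ (norm_muF p a t r) (betaF_nonneg p) (gdF p a) (XF p a) (XF' p a) (XF'_ne p a)
    (wt_XF p a) (fun k hk σ σ' => pair_XF p hp a ht r k hk σ σ') (W := 2 * ℓ)
    (fun _ _ _ _ _ _ => rfl) (fun _ _ _ _ => rfl) (fun _ _ _ _ _ => rfl) (fun _ _ _ => rfl)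
    (fun _ _ _ => by simp) n 0 [] 0

/-- mod-3 splitting for the form twist. -/
theorem three_mul_classSum_form (a : Fin n → ZMod p) (ℓ : ℕ) (y : Fin (n + 1) → (Fin n → Bool) → Bool)
    (hy : WindowLocal ℓ y) (hℓ : 1 ≤ ℓ) (hℓn : ℓ ≤ n) (c : ℕ) (w : ℕ) (hw : w < 3) (t : ZMod p) :
    (3 : ℂ) * ∑ u ∈ univ.filter (fun u : Fin n → Bool => wt u % 3 = w),
        (∏ g : Fin (n + 1), sgn (fires y c g u)) * (ZMod.stdAddChar (t * linF p a u) : ℂ) =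
      ∑ r : ZMod 3, ZMod.stdAddChar (-(r * (w : ZMod 3))) *
        PG (muF p a t r) (Etab ℓ y c w) (fun _ r P => ftab ℓ y c w r P) n 0 [] 0 := by
  rw [sum_filter, mul_sum]
  have key : ∀ u : Fin n → Bool,
      (3 : ℂ) * (if wt u % 3 = w then (∏ g : Fin (n + 1), sgn (fires y c g u)) * (ZMod.stdAddChar (t * linF p a u) : ℂ)
        else 0) =
      ∑ r : ZMod 3, ZMod.stdAddChar (-(r * (w : ZMod 3))) *
        (tw (muF p a t r) 0 u * pathSgn (Etab ℓ y c w) 0 [] 0 u * ftab ℓ y c w (regAt u n []) (0 + wt u)) := by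
    intro u
    have hind : (3 : ℂ) * (if wt u % 3 = w then (1 : ℂ) else 0) =
        ∑ r : ZMod 3, ZMod.stdAddChar (-(r * (w : ZMod 3))) * (ZMod.stdAddChar r : ℂ) ^ wt u := by
      have h1 : (wt u % 3 = w) ↔ ((wt u : ZMod 3) - (w : ZMod 3) = 0) := by
        rw [sub_eq_zero, ZMod.natCast_eq_natCast_iff', Nat.mod_eq_of_lt hw]
      have h2 := ite_eq_sum_char 3 ((wt u : ZMod 3) - (w : ZMod 3))
      simp only [Nat.cast_ofNat] at h2
      simp only [h1]
      rw [mul_ite, mul_one, mul_zero, h2]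
      refine sum_congr rfl fun r _ => ?_
      rw [mul_sub, show r * (wt u : ZMod 3) = (wt u : ZMod 3) * r by ring, sub_eq_add_neg, AddChar.map_add_eq_mul,
        char_natMul, mul_comm]
    simp only [tw_muF]
    by_cases hu : wt u % 3 = w
    · rw [if_pos hu] at hind ⊢
      rw [mul_one] at hind
      rw [sign_split_window ℓ y c w hy hℓ hℓn u (by rw [hu, Nat.mod_eq_of_lt hw])]
      calc (3 : ℂ) * (pathSgn (Etab ℓ y c w) 0 [] 0 u * ftab ℓ y c w (regAt u n []) (0 + wt u) *
              (ZMod.stdAddChar (t * linF p a u) : ℂ))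
          = (∑ r : ZMod 3, ZMod.stdAddChar (-(r * (w : ZMod 3))) * (ZMod.stdAddChar r : ℂ) ^ wt u) *
              (pathSgn (Etab ℓ y c w) 0 [] 0 u * ftab ℓ y c w (regAt u n []) (0 + wt u) *
                (ZMod.stdAddChar (t * linF p a u) : ℂ)) := by rw [← hind]
        _ = _ := by
            rw [Finset.sum_mul]
            refine sum_congr rfl fun r _ => ?_
            ring
    · rw [if_neg hu, mul_zero]
      rw [if_neg hu, mul_zero] at hind
      have : ∀ r : ZMod 3, ZMod.stdAddChar (-(r * (w : ZMod 3))) *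
          ((ZMod.stdAddChar (t * linF p a u) : ℂ) * (ZMod.stdAddChar r : ℂ) ^ wt u *
            pathSgn (Etab ℓ y c w) 0 [] 0 u * ftab ℓ y c w (regAt u n []) (0 + wt u)) =
          (ZMod.stdAddChar (-(r * (w : ZMod 3))) * (ZMod.stdAddChar r : ℂ) ^ wt u) *
            ((ZMod.stdAddChar (t * linF p a u) : ℂ) * pathSgn (Etab ℓ y c w) 0 [] 0 u *
              ftab ℓ y c w (regAt u n []) (0 + wt u)) := fun r => by ring
      rw [sum_congr rfl fun r _ => this r, ← sum_mul, ← hind, zero_mul]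
  simp only [key]
  rw [sum_comm]
  refine sum_congr rfl fun r _ => ?_
  rw [← mul_sum]
  rfl

/-- the bound at window `ℓ` and direction `a`: `BF = 2ⁿ κ_F^{nb}`. -/
def BF (a : Fin n → ZMod p) (ℓ : ℕ) : ℝ := 2 ^ n * kappaF p ^ nb (gdF p a) (2 * ℓ) 0 n

/-- CharDialFormJuntaC helper `BF_nonneg` (decomp-qadv land package; see the module docstring). -/
theorem BF_nonneg (a : Fin n → ZMod p) (ℓ : ℕ) : 0 ≤ BF p a ℓ := by
  unfold BF; have := kappaF_nonneg p; positivity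

/-- CharDialFormJuntaC helper `norm_classSum_form_le` (decomp-qadv land package; see the module docstring). -/
theorem norm_classSum_form_le (hp : 5 ≤ p) (a : Fin n → ZMod p) (ℓ : ℕ) (y : Fin (n + 1) → (Fin n → Bool) → Bool)
    (hy : WindowLocal ℓ y) (hℓ : 1 ≤ ℓ) (hℓn : ℓ ≤ n) (c : ℕ) (w : ℕ) (hw : w < 3) {t : ZMod p} (ht : t ≠ 0) :
    ‖∑ u ∈ univ.filter (fun u : Fin n → Bool => wt u % 3 = w),
        (∏ g : Fin (n + 1), sgn (fires y c g u)) * (ZMod.stdAddChar (t * linF p a u) : ℂ)‖ ≤ BF p a ℓ := by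
  have h3 := three_mul_classSum_form p a ℓ y hy hℓ hℓn c w hw t
  have key : ‖(3 : ℂ) * ∑ u ∈ univ.filter (fun u : Fin n → Bool => wt u % 3 = w),
        (∏ g : Fin (n + 1), sgn (fires y c g u)) * (ZMod.stdAddChar (t * linF p a u) : ℂ)‖ ≤ 3 * BF p a ℓ := by
    rw [h3]
    refine le_trans (norm_sum_le _ _) ?_
    calc _ ≤ ∑ r : ZMod 3, BF p a ℓ := sum_le_sum fun r _ => by
            rw [norm_mul, norm_char, one_mul]; exact norm_PG_form_le p hp a ht r ℓ y hy (by omega) c w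
      _ = 3 * BF p a ℓ := by rw [sum_const, card_univ, ZMod.card]; simp
  rw [norm_mul, (by norm_num : ‖(3 : ℂ)‖ = 3)] at key
  linarith

/-- CharDialFormJuntaC helper `norm_signedSum_form_le` (decomp-qadv land package; see the module docstring). -/
theorem norm_signedSum_form_le (hp : 5 ≤ p) (a : Fin n → ZMod p) (ℓ : ℕ)
    (y : Fin (n + 1) → (Fin n → Bool) → Bool) (hy : WindowLocal ℓ y) (hℓ : 1 ≤ ℓ) (hℓn : ℓ ≤ n) (c : ℕ)
    {t : ZMod p} (ht : t ≠ 0) :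
    ‖∑ u : Fin n → Bool, (∏ g : Fin (n + 1), sgn (fires y c g u)) * (ZMod.stdAddChar (t * linF p a u) : ℂ)‖
      ≤ 3 * BF p a ℓ := by
  rw [← sum_fiberwise_of_maps_to (s := univ) (t := range 3) (g := fun u : Fin n → Bool => wt u % 3)
    (fun u _ => mem_range.2 (Nat.mod_lt _ (by norm_num)))]
  refine le_trans (norm_sum_le _ _) ?_
  calc _ ≤ ∑ w ∈ range 3, BF p a ℓ :=
        sum_le_sum fun w hw => norm_classSum_form_le p hp a ℓ y hy hℓ hℓn c w (mem_range.1 hw) ht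
    _ = 3 * BF p a ℓ := by simp

/-- the form-twisted win sum `A_t^a(y) = Σ_u [WIN_y u] ψ_p(t ⟨a,u⟩)`. -/
def formSum (a : Fin n → ZMod p) (c : ℕ) (y : Fin (n + 1) → (Fin n → Bool) → Bool) (t : ZMod p) : ℂ :=
  ∑ u : Fin n → Bool, (if ringWinU c y u = true then (1 : ℂ) else 0) * (ZMod.stdAddChar (t * linF p a u) : ℂ)

/-- **form-twisted win sums of window strategies**: `‖A_t^a(y)‖ ≤ 2 · BF`. -/
theorem norm_formSum_window_le (hp : 5 ≤ p) (a : Fin n → ZMod p) (ℓ : ℕ) (hℓ : 1 ≤ ℓ) (hℓn : ℓ ≤ n)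
    (y : Fin (n + 1) → (Fin n → Bool) → Bool) (hy : WindowLocal ℓ y) (c : ℕ) {t : ZMod p} (ht : t ≠ 0) :
    ‖formSum p a c y t‖ ≤ 2 * BF p a ℓ := by
  unfold formSum
  simp only [win_indicator]
  have e : ∑ u : Fin n → Bool, (1 - ∏ g : Fin (n + 1), sgn (fires y c g u)) / 2 * (ZMod.stdAddChar (t * linF p a u) : ℂ)
      = ((∑ u : Fin n → Bool, (ZMod.stdAddChar (t * linF p a u) : ℂ)) -
          ∑ u : Fin n → Bool, (∏ g : Fin (n + 1), sgn (fires y c g u)) * (ZMod.stdAddChar (t * linF p a u) : ℂ)) / 2 := by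
    rw [sub_div, Finset.sum_div, Finset.sum_div, ← Finset.sum_sub_distrib]
    refine sum_congr rfl fun u _ => ?_; ring
  rw [e, norm_div, show ‖(2 : ℂ)‖ = 2 by norm_num]
  have h1 : ‖∑ u : Fin n → Bool, (ZMod.stdAddChar (t * linF p a u) : ℂ)‖ ≤ BF p a ℓ := by
    have hplain := norm_PG_form_plain_le p hp a ht 0 ℓ
    rw [← sum_tw_eq_PG] at hplain
    have e2 : ∑ u : Fin n → Bool, tw (muF p a t 0) 0 u = ∑ u : Fin n → Bool, (ZMod.stdAddChar (t * linF p a u) : ℂ) :=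
      sum_congr rfl fun u _ => by rw [tw_muF, AddChar.map_zero_eq_one, one_pow, mul_one]
    rw [e2] at hplain
    exact hplain
  have h2 := norm_signedSum_form_le p hp a ℓ y hy hℓ hℓn c ht
  calc _ ≤ (BF p a ℓ + 3 * BF p a ℓ) / 2 := by
        exact div_le_div_of_nonneg_right (le_trans (norm_sub_le _ _) (add_le_add h1 h2)) (by norm_num)
    _ = 2 * BF p a ℓ := by ring

/-- the good-position count is the support size. -/
theorem cnt_gdF (a : Fin n → ZMod p) : cnt (gdF p a) 0 n = (univ.filter fun i : Fin n => a i ≠ 0).card := by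
  unfold cnt
  rw [zero_add, ← range_eq_Ico, ← Fin.sum_univ_eq_sum_range (fun i => if gdF p a i = true then 1 else 0) n]
  rw [card_eq_sum_ones, sum_filter]
  refine sum_congr rfl fun i _ => ?_
  simp [gdF, aExt_val]

/-- **dense directions: the twisted win sums are small** (window `(log₂ n)^C`, `#supp a ≥ n/2`). -/
theorem form_twist_small_dense (hp : 5 ≤ p) (C : ℕ) : ∀ ε : ℝ, 0 < ε → ∃ n₁ : ℕ, ∀ n ≥ n₁,
    ∀ (c : ℕ) (a : Fin n → ZMod p) (y : Fin (n + 1) → (Fin n → Bool) → Bool), WindowLocal (Nat.log 2 n ^ C) y →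
      n ≤ 2 * (univ.filter fun i : Fin n => a i ≠ 0).card →
        ∀ t : ZMod p, t ≠ 0 → ‖formSum p a c y t‖ ≤ ε * 2 ^ n := by
  intro ε hε
  have hκ0 := kappaF_nonneg p
  have hκ1 := kappaF_lt_one p hp
  obtain ⟨q₀, hq₀⟩ := exists_pow_lt_of_lt_one (show 0 < ε / 2 by positivity) hκ1
  obtain ⟨N₀, hN₀⟩ := DWalk.const_mul_logPow_le' (10 * (q₀ + 1)) C
  refine ⟨max N₀ 2, fun n hn c a y hy hdense t ht => ?_⟩
  set ℓ := Nat.log 2 n ^ C with hℓdef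
  have hn2 : 2 ≤ n := le_trans (le_max_right _ _) hn
  have hℓ1 : 1 ≤ ℓ := Nat.one_le_pow _ _ (Nat.log_pos one_lt_two hn2)
  have hmain : 10 * (q₀ + 1) * ℓ ≤ n := hN₀ n (le_trans (le_max_left _ _) hn)
  have hℓn : ℓ ≤ n := by nlinarith
  -- enough blocks
  have hq : q₀ ≤ nb (gdF p a) (2 * ℓ) 0 n := by
    refine le_nb_of_cnt (gdF p a) (2 * ℓ) n 0 q₀ ?_
    rw [cnt_gdF]
    nlinarith
  have hB := norm_formSum_window_le p hp a ℓ hℓ1 hℓn y hy c ht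
  have e : kappaF p ^ nb (gdF p a) (2 * ℓ) 0 n ≤ ε / 2 := le_trans (pow_le_pow_of_le_one hκ0 hκ1.le hq) hq₀.le
  calc ‖formSum p a c y t‖ ≤ 2 * BF p a ℓ := hB
    _ = 2 * 2 ^ n * kappaF p ^ nb (gdF p a) (2 * ℓ) 0 n := by unfold BF; ring
    _ ≤ 2 * 2 ^ n * (ε / 2) := by gcongr
    _ = ε * 2 ^ n := by ring

/-! ### the form dial and its Fourier reduction -/

/-- the form dial: consult the value `⟨a,u⟩ mod p`, then play the class strategy. -/
def formStrat (a : Fin n → ZMod p) (Y : ZMod p → Fin (n + 1) → (Fin n → Bool) → Bool) :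
    Fin (n + 1) → (Fin n → Bool) → Bool := fun g u => Y (linF p a u) g u

/-- CharDialFormJuntaC helper `card_win_form_eq_sum` (decomp-qadv land package; see the module docstring). -/
theorem card_win_form_eq_sum (c : ℕ) (a : Fin n → ZMod p) (Y : ZMod p → Fin (n + 1) → (Fin n → Bool) → Bool) :
    #{u : Fin n → Bool | ringWinU c (formStrat p a Y) u = true} =
      ∑ s : ZMod p, #{u : Fin n → Bool | ringWinU c (Y s) u = true ∧ linF p a u = s} := by
  rw [card_eq_sum_card_fiberwise (f := fun u : Fin n → Bool => linF p a u) (t := univ) fun u _ => mem_univ _]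
  refine sum_congr rfl fun s _ => ?_
  rw [filter_filter]
  congr 1
  refine filter_congr fun u _ => ?_
  refine ⟨fun h => ⟨?_, h.2⟩, fun h => ⟨?_, h.2⟩⟩
  · rw [← h.1]; symm
    exact UnreadTwist.ringWinU_congr fun g => by simp only [formStrat, h.2]
  · rw [← h.1]
    exact UnreadTwist.ringWinU_congr fun g => by simp only [formStrat, h.2]

/-- the class bound in the form value: `p · #{⟨a,u⟩ = s, WIN_y} ≤ #WIN_y + Σ_{t ≠ 0} ‖A_t^a(y)‖`. -/
theorem class_count_le_form (c : ℕ) (a : Fin n → ZMod p) (y : Fin (n + 1) → (Fin n → Bool) → Bool) (s : ZMod p) :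
    (p : ℝ) * #{u : Fin n → Bool | ringWinU c y u = true ∧ linF p a u = s} ≤
      #{u : Fin n → Bool | ringWinU c y u = true} + ∑ t ∈ univ.erase (0 : ZMod p), ‖formSum p a c y t‖ := by
  have hid : (p : ℂ) * ((#{u : Fin n → Bool | ringWinU c y u = true ∧ linF p a u = s} : ℕ) : ℂ) =
      ∑ t : ZMod p, ZMod.stdAddChar (-(t * s)) * formSum p a c y t := by
    have e1 : ((#{u : Fin n → Bool | ringWinU c y u = true ∧ linF p a u = s} : ℕ) : ℂ) =
        ∑ u : Fin n → Bool, (if ringWinU c y u = true then (1 : ℂ) else 0) *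
          (if linF p a u - s = 0 then (1 : ℂ) else 0) := by
      rw [← sum_boole]
      refine sum_congr rfl fun u _ => ?_
      by_cases h1 : linF p a u = s <;> by_cases h2 : ringWinU c y u = true <;> simp [h1, h2, sub_eq_zero]
    rw [e1, mul_sum]
    have e2 : ∀ u : Fin n → Bool, (p : ℂ) * ((if ringWinU c y u = true then (1 : ℂ) else 0) *
        (if linF p a u - s = 0 then (1 : ℂ) else 0)) =
        ∑ t : ZMod p, ZMod.stdAddChar (-(t * s)) *
          ((if ringWinU c y u = true then (1 : ℂ) else 0) * (ZMod.stdAddChar (t * linF p a u) : ℂ)) := by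
      intro u
      have h := ite_eq_sum_char p (linF p a u - s)
      rw [show (if linF p a u - s = 0 then (p : ℂ) else 0) = (p : ℂ) * (if linF p a u - s = 0 then 1 else 0)
        by rw [mul_ite, mul_one, mul_zero]] at h
      rw [mul_left_comm, h, mul_sum]
      refine sum_congr rfl fun t _ => ?_
      rw [mul_sub, sub_eq_add_neg, AddChar.map_add_eq_mul]
      ring
    simp only [e2]
    rw [sum_comm]
    refine sum_congr rfl fun t _ => ?_
    rw [formSum, mul_sum]
  have hA0 : formSum p a c y 0 = (#{u : Fin n → Bool | ringWinU c y u = true} : ℂ) := by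
    rw [formSum]; simp only [zero_mul, AddChar.map_zero_eq_one, mul_one]; rw [sum_boole]
  have hnorm : (p : ℝ) * #{u : Fin n → Bool | ringWinU c y u = true ∧ linF p a u = s} ≤
      ∑ t : ZMod p, ‖formSum p a c y t‖ := by
    have : (p : ℝ) * #{u : Fin n → Bool | ringWinU c y u = true ∧ linF p a u = s} =
        ‖(p : ℂ) * ((#{u : Fin n → Bool | ringWinU c y u = true ∧ linF p a u = s} : ℕ) : ℂ)‖ := by
      rw [norm_mul, Complex.norm_natCast, Complex.norm_natCast]
    rw [this, hid]
    refine le_trans (norm_sum_le _ _) (sum_le_sum fun t _ => ?_)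
    rw [norm_mul, norm_char, one_mul]
  rw [← add_sum_erase univ (fun t => ‖formSum p a c y t‖) (mem_univ (0 : ZMod p)), hA0] at hnorm
  simpa only [Complex.norm_natCast] using hnorm

/-- **FORM-DIAL FOURIER REDUCTION on dense directions** (explicit rate `(1+θ₀)/2`). -/
theorem form_reduction (good : ∀ {n : ℕ}, ℕ → (Fin (n + 1) → (Fin n → Bool) → Bool) → Prop) {θ₀ : ℝ}
    (h1 : ∃ n₀ : ℕ, ∀ n ≥ n₀, ∀ (c : ℕ) (y : Fin (n + 1) → (Fin n → Bool) → Bool),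
      good c y → (#{u : Fin n → Bool | ringWinU c y u = true} : ℝ) ≤ θ₀ * 2 ^ n)
    (h2 : ∀ ε : ℝ, 0 < ε → ∃ n₁ : ℕ, ∀ n ≥ n₁, ∀ (c : ℕ) (a : Fin n → ZMod p)
      (y : Fin (n + 1) → (Fin n → Bool) → Bool), good c y → n ≤ 2 * (univ.filter fun i : Fin n => a i ≠ 0).card →
        ∀ t : ZMod p, t ≠ 0 → ‖formSum p a c y t‖ ≤ ε * 2 ^ n) (hθ₀ : θ₀ < 1) :
    ∃ n₂ : ℕ, ∀ n ≥ n₂, ∀ (c : ℕ) (a : Fin n → ZMod p) (Y : ZMod p → Fin (n + 1) → (Fin n → Bool) → Bool),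
      n ≤ 2 * (univ.filter fun i : Fin n => a i ≠ 0).card → (∀ s, good c (Y s)) →
        (#{u : Fin n → Bool | ringWinU c (formStrat p a Y) u = true} : ℝ) ≤ (θ₀ + (1 - θ₀) / 2) * 2 ^ n := by
  obtain ⟨n₀, hn₀⟩ := h1
  have hp0 : (0 : ℝ) < p := by exact_mod_cast (Fact.out : p.Prime).pos
  set ε : ℝ := (1 - θ₀) / 2 with hε
  have hε0 : 0 < ε := by rw [hε]; linarith
  obtain ⟨n₁, hn₁⟩ := h2 (ε / p) (by positivity)
  refine ⟨max n₀ n₁, fun n hn c a Y hdense hY => ?_⟩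
  have hA : n₀ ≤ n := le_trans (le_max_left _ _) hn
  have hB : n₁ ≤ n := le_trans (le_max_right _ _) hn
  have hcls : ∀ s : ZMod p,
      (p : ℝ) * #{u : Fin n → Bool | ringWinU c (Y s) u = true ∧ linF p a u = s} ≤ θ₀ * 2 ^ n + ε * 2 ^ n := by
    intro s
    refine le_trans (class_count_le_form p c a (Y s) s) (add_le_add (hn₀ n hA c _ (hY s)) ?_)
    calc ∑ t ∈ univ.erase (0 : ZMod p), ‖formSum p a c (Y s) t‖ ≤ ∑ t ∈ univ.erase (0 : ZMod p), ε / p * 2 ^ n :=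
          sum_le_sum fun t ht => hn₁ n hB c a _ (hY s) hdense t (ne_of_mem_erase ht)
      _ ≤ p * (ε / p * 2 ^ n) := by
          rw [sum_const, nsmul_eq_mul]
          refine mul_le_mul_of_nonneg_right ?_ (by positivity)
          exact_mod_cast le_trans card_erase_le (by rw [card_univ, ZMod.card])
      _ = ε * 2 ^ n := by field_simp
  have hsum : (p : ℝ) * #{u : Fin n → Bool | ringWinU c (formStrat p a Y) u = true} ≤
      p * (θ₀ * 2 ^ n + ε * 2 ^ n) := by
    rw [card_win_form_eq_sum p c a Y]
    push_cast
    rw [mul_sum]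
    calc _ ≤ ∑ s : ZMod p, (θ₀ * 2 ^ n + ε * 2 ^ n) := sum_le_sum fun s _ => hcls s
      _ = p * (θ₀ * 2 ^ n + ε * 2 ^ n) := by rw [sum_const, card_univ, ZMod.card, nsmul_eq_mul]
  have := le_of_mul_le_mul_left hsum hp0
  linarith

end FormDial

/-! ## §H SPARSE directions by subcube slicing, and the theorem `formWindow_hard`

If `2·#{i : a_i ≠ 0} ≤ n`, fix the bits on `W = supp a`: on each subcube `{u_W = b}` the form `⟨a,u⟩` is constant, so
the form dial restricted to the subcube is a window strategy, each cut a junta of `≤ 2ℓ ≤ (log₂ n)^{C+1}` free bits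
— the tree's `AffBells22.walkHardAllSubcube` (density `δ₀ = 1/2`, ONE `θ`) bounds every subcube, and fibre counting
sums them.  `formWindow_hard` = sparse half ⊔ dense half (`form_reduction` fed by `windowLocalHardU` and
`form_twist_small_dense`). -/

section FormSparse

open AffBells22 Literature.Computability.MetaComplexity Literature.Computability.MetaComplexity.Smolensky

variable (p : ℕ) [Fact p.Prime] {n : ℕ}


end FormSparse
end Summit.QuantumAdvantage.AdviceFreeQNC0.WindowCounter
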